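import Mathlib
import Summits.MatrixMultiplication.MatrixMultiplication.Theorems.SubgroupIdentityDesigns.Negative.EndPlacements

/-!
# The `(2,1)` cell at `p = 3`: no level-one witness (a complete, computer-free proof)

Route `LevelGradedCohnUmans`, crux `SubgroupIdentityDesigns`, the `(m,k) = (2,1)` cell, `p = 3`.

The all-`p` volume laws leave `p = 3` open (the one-`p`-member bound `p(p+1)²(p-1) = 96` exceeds
the floor `f(3) = 92`).  Here `p = 3` is closed by elementary group theory of `GL₂(𝔽₃)`:

* `card_mul_add_card_le` (all `p`): subgroup TPP ⇒ `|H₁||H₂| + |H₃| ≤ |GL₂(𝔽_p)| + 1`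
  (the products `ab` and the inverses `c⁻¹ ≠ 1` are pairwise distinct);
* `det_eq_neg_one_of_mul_self` (all `p`): an involution `r ≠ ±1` has `det r = -1` (Cayley–Hamilton);
  hence in `GL₂(𝔽₃)` an element with `g⁴ = 1 ≠ g²` has `g² = -1`, and two distinct commuting
  involutions `≠ ±1` multiply to `-1`;
* `card_dvd_six_of_neg_one_not_mem`: a subgroup of `GL₂(𝔽₃)` not containing `-1` has order
  dividing `6` (a subgroup of order `4` would contain `-1`; Sylow);
* TPP members are pairwise disjoint, so at most one contains `-1`; unless two members have order
  divisible by `3` (closed for all `p ≥ 3` by `EndPlacements`), the counting gives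
  `|H₁||H₂||H₃| ≤ 64 ≤ 92` (`no_levelOne_witness_three`).

Exhaustive data (`code/g14/p3_census.py` in the route folder) agrees: 23 899 ordered TPP triples,
maximal volume `72`.  VALUE = THEOREM (`p = 3` slice), NOT summit progress; the crux item
stmt-MatrixMultiplication-14079 is untouched and remains open.
-/

set_option linter.dupNamespace false

noncomputable section

open scoped BigOperators Classical

open Summit.MatrixMultiplication.MatrixMultiplication.Theorems.LieRankDesigns.Negative
  (GLm Mat fourierFn budget)
open Summit.MatrixMultiplication.MatrixMultiplication.Theorems.LevelOneGL2Designs.Negative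
  (levelSubmodule fourierFn_mem_levelSubmodule)

namespace Summit.MatrixMultiplication.MatrixMultiplication.Theorems.SubgroupIdentityDesigns.Negative

section PThree

open Literature.Barriers.MatrixMultiplication (SubgroupTPP)

section AllP

variable {p : ℕ} [hp : Fact p.Prime]

omit hp in
/-- Cyclic rotation of the subgroup TPP. -/
theorem subgroupTPP_rotate {H₁ H₂ H₃ : Subgroup (GLm p 2)} (h : SubgroupTPP H₁ H₂ H₃) :
    SubgroupTPP H₂ H₃ H₁ := by
  intro b hb c hc a ha hbca
  have habc : a * b * c = 1 := by
    have e : a * b * c = a * (b * c * a) * a⁻¹ := by group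
    rw [e, hbca, mul_one, mul_inv_cancel]
  obtain ⟨h1, h2, h3⟩ := h a ha b hb c hc habc
  exact ⟨h2, h3, h1⟩

/-- **TPP counting** (all `p`): `|H₁|·|H₂| + |H₃| ≤ |GL₂(𝔽_p)| + 1` — the products `ab` and the
inverses of the non-trivial elements of `H₃` are pairwise distinct. -/
theorem card_mul_add_card_le {H₁ H₂ H₃ : Subgroup (GLm p 2)} (htpp : SubgroupTPP H₁ H₂ H₃) :
    Nat.card H₁ * Nat.card H₂ + Nat.card H₃ ≤ Nat.card (GLm p 2) + 1 := by
  let F : (H₁ × H₂) ⊕ {c : H₃ // ¬ c = 1} → GLm p 2 :=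
    Sum.elim (fun q => (q.1 : GLm p 2) * (q.2 : GLm p 2)) (fun c => ((c.1 : H₃) : GLm p 2)⁻¹)
  have hF : Function.Injective F := by
    rintro (⟨a, b⟩ | ⟨c, hc⟩) (⟨a', b'⟩ | ⟨c', hc'⟩) h
    · simp only [F, Sum.elim_inl] at h
      have key := htpp ((a' : GLm p 2)⁻¹ * a) (H₁.mul_mem (H₁.inv_mem a'.2) a.2)
        (b * (b' : GLm p 2)⁻¹) (H₂.mul_mem b.2 (H₂.inv_mem b'.2)) 1 H₃.one_mem (by
          rw [mul_one, show (a' : GLm p 2)⁻¹ * a * (b * (b' : GLm p 2)⁻¹) =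
            (a' : GLm p 2)⁻¹ * (a * b) * (b' : GLm p 2)⁻¹ by group, h]
          group)
      obtain ⟨k1, k2, -⟩ := key
      obtain rfl : a = a' := Subtype.ext (inv_mul_eq_one.mp k1).symm
      obtain rfl : b = b' := Subtype.ext (mul_inv_eq_one.mp k2)
      rfl
    · simp only [F, Sum.elim_inl, Sum.elim_inr] at h
      have key := htpp a a.2 b b.2 c' c'.2 (by rw [h, inv_mul_cancel])
      exact absurd (Subtype.ext key.2.2) hc'
    · simp only [F, Sum.elim_inl, Sum.elim_inr] at h
      have key := htpp a' a'.2 b' b'.2 c c.2 (by rw [← h, inv_mul_cancel])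
      exact absurd (Subtype.ext key.2.2) hc
    · simp only [F, Sum.elim_inr] at h
      obtain rfl : c = c' := Subtype.ext (inv_injective h)
      rfl
  have h1 := Nat.card_le_card_of_injective F hF
  have h2 : Nat.card {c : H₃ // ¬ c = 1} = Nat.card H₃ - 1 := by
    rw [Nat.card_eq_fintype_card, Fintype.card_subtype_compl, Fintype.card_subtype_eq,
      ← Nat.card_eq_fintype_card]
  rw [Nat.card_sum, Nat.card_prod, h2] at h1
  have h3 : 0 < Nat.card H₃ := Nat.card_pos
  omega

/-- The square of a `2 × 2` matrix (Cayley–Hamilton): `m² = tr(m)·m − det(m)·1`. -/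
theorem mul_self_eq_trace_smul_sub (m : Mat p 2) :
    m * m = m.trace • m - m.det • (1 : Mat p 2) := by
  ext i j
  rw [Matrix.trace_fin_two, Matrix.det_fin_two]
  fin_cases i <;> fin_cases j <;>
    simp [Matrix.mul_apply, Fin.sum_univ_two] <;> ring

/-- **An involution `r ≠ ±1` of `GL₂` has determinant `-1`** (all `p`). -/
theorem det_eq_neg_one_of_mul_self {r : GLm p 2} (h : r * r = 1) (h1 : r ≠ 1) (hn : r ≠ -1) :
    (r : Mat p 2).det = -1 := by
  have hCH := mul_self_eq_trace_smul_sub (r : Mat p 2)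
  have hrr : (r : Mat p 2) * (r : Mat p 2) = 1 := by rw [← Units.val_mul, h, Units.val_one]
  rw [hrr] at hCH
  -- `tr(r) • r = (1 + det r) • 1`
  have key : (r : Mat p 2).trace • (r : Mat p 2) = (1 + (r : Mat p 2).det) • (1 : Mat p 2) := by
    rw [add_smul, one_smul]; exact (eq_sub_iff_add_eq.mp hCH).symm
  by_cases ht : (r : Mat p 2).trace = 0
  · rw [ht, zero_smul] at key
    have e := congrFun (congrFun key 0) 0
    simp only [Matrix.zero_apply, Matrix.smul_apply, Matrix.one_apply_eq, smul_eq_mul,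
      mul_one] at e
    linear_combination -e
  · exfalso
    -- `r` is the scalar `c = (1 + det r)/tr r`, and `c² = 1` forces `r = ±1`
    set c : ZMod p := ((r : Mat p 2).trace)⁻¹ * (1 + (r : Mat p 2).det) with hc
    have hr : (r : Mat p 2) = c • (1 : Mat p 2) := by
      have e := congrArg (fun M : Mat p 2 => ((r : Mat p 2).trace)⁻¹ • M) key
      simp only [smul_smul, inv_mul_cancel₀ ht, one_smul] at e
      exact e
    have hc2 : c * c = 1 := by
      have e := congrFun (congrFun hrr 0) 0
      rw [hr] at e
      simpa [Matrix.mul_apply, Fin.sum_univ_two, Matrix.smul_apply, Matrix.one_apply] using e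
    rcases mul_self_eq_one_iff.mp hc2 with h1' | h1'
    · exact h1 (Units.ext (by rw [hr, h1', one_smul, Units.val_one]))
    · exact hn (Units.ext (by rw [hr, h1', Units.val_neg, Units.val_one, neg_smul, one_smul]))

end AllP

/-! ### `GL₂(𝔽₃)` -/

/-- In `GL₂(𝔽₃)`: `g⁴ = 1 ≠ g²` forces `g² = -1`. -/
theorem sq_eq_neg_one_of_pow_four {g : GLm 3 2} (h4 : g ^ 4 = 1) (h2 : g ^ 2 ≠ 1) :
    g ^ 2 = -1 := by
  by_contra hn
  have hss : g ^ 2 * g ^ 2 = 1 := by rw [← pow_add, show (2 : ℕ) + 2 = 4 from rfl, h4]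
  have hdet := det_eq_neg_one_of_mul_self hss h2 hn
  have hδ : (g : Mat 3 2).det ≠ 0 :=
    ((Matrix.isUnit_iff_isUnit_det _).mp g.isUnit).ne_zero
  have hf := ZMod.pow_card_sub_one_eq_one hδ
  rw [Units.val_pow_eq_pow_val, Matrix.det_pow] at hdet
  change (g : Mat 3 2).det ^ 2 = 1 at hf
  rw [hf] at hdet
  exact absurd hdet (by decide)

/-- In `GL₂(𝔽₃)`: two distinct commuting involutions `≠ ±1` multiply to `-1`. -/
theorem mul_eq_neg_one_of_involutions {r s : GLm 3 2} (hr : r * r = 1) (hs : s * s = 1)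
    (hr1 : r ≠ 1) (hrn : r ≠ -1) (hs1 : s ≠ 1) (hsn : s ≠ -1) (hcomm : r * s = s * r)
    (hne : r ≠ s) : r * s = -1 := by
  by_contra hn
  have hrs : r * s * (r * s) = 1 := by
    rw [show r * s * (r * s) = r * (s * r) * s by group, ← hcomm,
      show r * (r * s) * s = r * r * (s * s) by group, hr, hs, one_mul]
  have h1 : r * s ≠ 1 := by
    intro e
    have e' : s = r⁻¹ := eq_inv_of_mul_eq_one_right e
    rw [e', ← mul_eq_one_iff_eq_inv.mp hr] at hne
    exact hne rfl
  have hdet := det_eq_neg_one_of_mul_self hrs h1 hn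
  rw [Units.val_mul, Matrix.det_mul, det_eq_neg_one_of_mul_self hr hr1 hrn,
    det_eq_neg_one_of_mul_self hs hs1 hsn] at hdet
  exact absurd hdet (by decide)

/-- `|GL₂(𝔽₃)| = 48`. -/
theorem card_GL_three : Nat.card (GLm 3 2) = 48 := by
  show Nat.card (GL (Fin 2) (ZMod 3)) = 48
  rw [Matrix.card_GL_field]; simp [Fin.prod_univ_two, ZMod.card]

/-- **A subgroup of `GL₂(𝔽₃)` avoiding `-1` has order dividing `6`.** -/
theorem card_dvd_six_of_neg_one_not_mem {H : Subgroup (GLm 3 2)} (hH : (-1 : GLm 3 2) ∉ H) :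
    Nat.card H ∣ 6 := by
  have h48 : Nat.card H ∣ 48 := by
    have := Subgroup.card_subgroup_dvd_card H; rwa [card_GL_three] at this
  have h4 : ¬ 4 ∣ Nat.card H := by
    intro h4
    have h4' : 2 ^ 2 ∣ Nat.card H := by rw [show (2 : ℕ) ^ 2 = 4 from rfl]; exact h4
    obtain ⟨P, hP⟩ := Sylow.exists_subgroup_card_pow_prime (G := H) 2 h4'
    have hx4 : ∀ x : P, (((x : P) : H) : GLm 3 2) ^ 4 = 1 := fun x => by
      have e : x ^ Nat.card P = 1 := pow_card_eq_one'
      rw [hP] at e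
      have e' := congrArg (fun y : P => ((y : H) : GLm 3 2)) e
      simpa using e'
    have hx2 : ∀ x : P, (((x : P) : H) : GLm 3 2) ^ 2 = 1 := fun x => by
      by_contra hne
      have e := sq_eq_neg_one_of_pow_four (hx4 x) hne
      exact hH (by rw [← e]; exact H.pow_mem (x : H).2 2)
    have hne1 : ∀ x : P, x ≠ 1 → (((x : P) : H) : GLm 3 2) ≠ 1 := fun x hx e =>
      hx (Subtype.ext (Subtype.ext e))
    have hmem : ∀ x : P, (((x : P) : H) : GLm 3 2) ∈ H := fun x => (x : H).2
    have hnn : ∀ x : P, (((x : P) : H) : GLm 3 2) ≠ -1 := fun x e => hH (e ▸ hmem x)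
    -- two distinct non-identity elements of `P`
    have hcardP : 2 < Nat.card P := by rw [hP]; decide
    rw [Nat.card_eq_fintype_card, Fintype.two_lt_card_iff] at hcardP
    obtain ⟨a, b, c, hab, hac, hbc⟩ := hcardP
    obtain ⟨x, y, hx, hy, hxy⟩ : ∃ x y : P, x ≠ 1 ∧ y ≠ 1 ∧ x ≠ y := by
      by_cases ha : a = 1
      · exact ⟨b, c, fun e => hab (ha.trans e.symm), fun e => hac (ha.trans e.symm), hbc⟩
      · by_cases hb : b = 1
        · exact ⟨a, c, ha, fun e => hbc (hb.trans e.symm), hac⟩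
        · exact ⟨a, b, ha, hb, hab⟩
    have hsq : ∀ z : P, (((z : P) : H) : GLm 3 2) * (((z : P) : H) : GLm 3 2) = 1 :=
      fun z => by rw [← sq]; exact hx2 z
    have exy := hsq (x * y)
    simp only [Subgroup.coe_mul] at exy
    have ex := hsq x
    have ey := hsq y
    set X := (((x : P) : H) : GLm 3 2) with hX
    set Y := (((y : P) : H) : GLm 3 2) with hY
    have iX : X⁻¹ = X := (mul_eq_one_iff_eq_inv.mp ex).symm
    have iY : Y⁻¹ = Y := (mul_eq_one_iff_eq_inv.mp ey).symm
    have hcomm : X * Y = Y * X :=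
      calc X * Y = (X * Y)⁻¹ := mul_eq_one_iff_eq_inv.mp exy
        _ = Y⁻¹ * X⁻¹ := mul_inv_rev X Y
        _ = Y * X := by rw [iX, iY]
    have hXY : X ≠ Y := fun e => hxy (Subtype.ext (Subtype.ext e))
    have key := mul_eq_neg_one_of_involutions ex ey (hne1 x hx) (hnn x) (hne1 y hy) (hnn y)
      hcomm hXY
    exact hH (key ▸ H.mul_mem (hmem x) (hmem y))
  have hle : Nat.card H ≤ 48 := Nat.le_of_dvd (by decide) h48
  have h0 : 0 < Nat.card H := Nat.card_pos
  obtain ⟨n, hn⟩ : ∃ n, Nat.card H = n := ⟨_, rfl⟩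
  rw [hn] at h48 h4 hle h0 ⊢
  interval_cases n <;> omega

/-- `-1 ≠ 1` in `GL₂(𝔽₃)`. -/
theorem neg_one_ne_one_three : (-1 : GLm 3 2) ≠ 1 := fun e => by
  have h := congrArg (fun u : GLm 3 2 => (u : Mat 3 2) 0 0) e
  simp only [Units.val_neg, Units.val_one, Matrix.neg_apply, Matrix.one_apply_eq] at h
  exact absurd h (by decide)

/-- The arithmetic endgame at `p = 3`. -/
theorem volume_arith_three {a b c : ℕ} (ha : 0 < a) (hb : 0 < b) (hc : 0 < c)
    (h6 : (b ∣ 6 ∧ c ∣ 6) ∨ (a ∣ 6 ∧ c ∣ 6) ∨ (a ∣ 6 ∧ b ∣ 6))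
    (h12 : a * b + c ≤ 49) (h23 : b * c + a ≤ 49) (h31 : c * a + b ≤ 49) :
    a * b * c ≤ 92 ∨ ((3 ∣ a ∧ 3 ∣ b) ∨ (3 ∣ a ∧ 3 ∣ c) ∨ (3 ∣ b ∧ 3 ∣ c)) := by
  rcases h6 with ⟨h, h'⟩ | ⟨h, h'⟩ | ⟨h, h'⟩
  · have hb6 : b ≤ 6 := Nat.le_of_dvd (by decide) h
    have hc6 : c ≤ 6 := Nat.le_of_dvd (by decide) h'
    interval_cases b <;> interval_cases c <;> omega
  · have ha6 : a ≤ 6 := Nat.le_of_dvd (by decide) h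
    have hc6 : c ≤ 6 := Nat.le_of_dvd (by decide) h'
    interval_cases a <;> interval_cases c <;> omega
  · have ha6 : a ≤ 6 := Nat.le_of_dvd (by decide) h
    have hb6 : b ≤ 6 := Nat.le_of_dvd (by decide) h'
    interval_cases a <;> interval_cases b <;> omega

/-- **The `p = 3` volume law.**  A subgroup TPP triple in `GL₂(𝔽₃)` has volume `≤ 92 = f(3)`
unless two of its members have order divisible by `3`. -/
theorem volume_le_or_two_threeMembers {H₁ H₂ H₃ : Subgroup (GLm 3 2)}
    (htpp : SubgroupTPP H₁ H₂ H₃) :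
    Nat.card H₁ * Nat.card H₂ * Nat.card H₃ ≤ 92 ∨
      ((3 ∣ Nat.card H₁ ∧ 3 ∣ Nat.card H₂) ∨ (3 ∣ Nat.card H₁ ∧ 3 ∣ Nat.card H₃) ∨
        (3 ∣ Nat.card H₂ ∧ 3 ∣ Nat.card H₃)) := by
  have hα₃ := card_mul_add_card_le htpp
  have hα₁ := card_mul_add_card_le (subgroupTPP_rotate htpp)
  have hα₂ := card_mul_add_card_le (subgroupTPP_rotate (subgroupTPP_rotate htpp))
  rw [card_GL_three] at hα₁ hα₂ hα₃
  obtain ⟨hd₁₂, hd₁₃, hd₂₃⟩ := StandardLines.subgroupTPP_disjoint htpp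
  have hexcl : ∀ {K L : Subgroup (GLm 3 2)}, Disjoint K L → (-1 : GLm 3 2) ∈ K →
      (-1 : GLm 3 2) ∉ L := fun hKL hK hL =>
    neg_one_ne_one_three (Subgroup.disjoint_def.mp hKL hK hL)
  have h6 : (Nat.card H₂ ∣ 6 ∧ Nat.card H₃ ∣ 6) ∨ (Nat.card H₁ ∣ 6 ∧ Nat.card H₃ ∣ 6) ∨
      (Nat.card H₁ ∣ 6 ∧ Nat.card H₂ ∣ 6) := by
    by_cases hm1 : (-1 : GLm 3 2) ∈ H₁
    · exact Or.inl ⟨card_dvd_six_of_neg_one_not_mem (hexcl hd₁₂ hm1),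
        card_dvd_six_of_neg_one_not_mem (hexcl hd₁₃ hm1)⟩
    · by_cases hm2 : (-1 : GLm 3 2) ∈ H₂
      · exact Or.inr (Or.inl ⟨card_dvd_six_of_neg_one_not_mem hm1,
          card_dvd_six_of_neg_one_not_mem (hexcl hd₂₃ hm2)⟩)
      · exact Or.inr (Or.inr ⟨card_dvd_six_of_neg_one_not_mem hm1,
          card_dvd_six_of_neg_one_not_mem hm2⟩)
  exact volume_arith_three Nat.card_pos Nat.card_pos Nat.card_pos h6 hα₃ hα₁ hα₂

/-- **Main theorem (`p = 3`, `0 < ε ≤ 1`).**  No subgroup TPP triple of `GL₂(𝔽₃)` carrying a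
level-`1` identity design satisfies the crux inequality: the `(2,1)` cell of
`SubgroupIdentityDesigns` has no witness at `p = 3`. -/
theorem no_levelOne_witness_three {ε : ℝ} (hε : 0 < ε) (hε1 : ε ≤ 1)
    {H₁ H₂ H₃ : Subgroup (GLm 3 2)} (htpp : SubgroupTPP H₁ H₂ H₃)
    (hdesign : ∃ c : Mat 3 2 → ℂ, (∀ M, 1 < M.rank → c M = 0) ∧
      (∑ M, c M * ZMod.stdAddChar (Matrix.trace (M * ((1 : GLm 3 2) : Mat 3 2)))) = 1 ∧
      ∀ a ∈ H₁, ∀ b ∈ H₂, ∀ g ∈ H₃, a * b * g ≠ 1 →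
        (∑ M, c M *
          ZMod.stdAddChar (Matrix.trace (M * ((a * b * g : GLm 3 2) : Mat 3 2)))) = 0) :
    ¬ budget 3 2 1 (2 + ε) <
      ((Nat.card H₁ * Nat.card H₂ * Nat.card H₃ : ℕ) : ℝ) ^ ((2 + ε) / 3) := by
  rcases volume_le_or_two_threeMembers htpp with hV | ⟨h₁, h₂⟩ | ⟨h₁, h₃⟩ | ⟨h₂, h₃⟩
  · exact no_levelOne_witness_of_volume_le_nat (by linarith) hε1 (hV.trans (by decide))
  · exact no_levelOne_witness_two_pMembers₁₂ le_rfl hε hε1 htpp h₁ h₂ hdesign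
  · exact no_levelOne_witness_two_pMembers₁₃ le_rfl hε hε1 htpp h₁ h₃ hdesign
  · exact no_levelOne_witness_two_pMembers₂₃ le_rfl hε hε1 htpp h₂ h₃ hdesign

end PThree

end Summit.MatrixMultiplication.MatrixMultiplication.Theorems.SubgroupIdentityDesigns.Negative

end
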